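import Summits.KontsevichZagierPeriods.KontsevichZagierPeriods.Theorems.FermatIsogenyBetaProductSectorStubDdStepLaps
import Summits.KontsevichZagierPeriods.KontsevichZagierPeriods.Theorems.FermatIsogenyBetaProductSectorStubDdStepLeft

/-!
# `BetaProductSector` (stmt-KontsevichZagierPeriods-3898), line `registered` (v3) — stub `stub_ddStep`,
# part 5: integrands and pointwise identities of the right chain of the two-duplication move DD

Fifth part of the two-duplication move DD `B(c+½-d, 2c+2d)·B(c,d) = 4^d·B(2c, c+d+½)·B(c+½-d, d)`. Part 4
(`DdStep.left_chain`) carried the unweighted left box onto the parameter surface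
`P = {(w,v) | 0 < w, w(1+w) < v(1-v)}` with the left integrand `ℓ = 4 F^{c-½-d} X^{d-1} D (v+w)`
(`F = (1+w-v)(v(1-v)-w(1+w))`, `X = 4wv((1-v)²+w(2+w-v))`, `D = w²+2w+(1-v)²`). Here `[P, ℓ]` is carried onto the
(by `4^d` weighted) RIGHT box `[(0,1)², 4^d x^{2c-1}(1-x)^{c+d-½} y^{c-½-d}(1-y)^{d-1}]` (`DdStep.right_chain`,
part 6); this file supplies the unfolded Euler–Mellin integrands and the pointwise identities of that chain:

* the polynomial identity `D(v+w) = v·N_R + w·N_E` (`N_R = -∂F/∂w = 3w²+2(2-v)w+(1-v)²`,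
  `N_E = ∂F/∂v = 3v²-2(2+w)v+(1+w)²`) splits `ℓ = H + G` with `H = 4F^{c-½-d}X^{d-1}·vN_R ≥ 0` and the
  SIGN-CHANGING ghost term `G = 4F^{c-½-d}X^{d-1}·wN_E` (rule (1b) on each of the two laps `P₊ = P ∩ {N_E > 0}`,
  `P₋ = P ∩ {N_E < 0}` of part 3, after discarding the null curve `P ∩ {N_E = 0}`, rule (1a));
* the ghost chart `(w,v) ↦ (w,F)` of part 3 (`DdStep.exists_chartPE`, Jacobian `N_E`, injective on each lap, the two
  laps having the same image `E`) carries `[P₊, G]` and `[P₋, -G]` onto ONE representation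
  `[E, 4 φ^{c-½-d} (4(w²(1+w)²+wφ))^{d-1} w]`, so the ghost terms cancel (rule (2) twice: the branch exchange);
* the chart `(w,v) ↦ (v,F)` of part 2 (`DdStep.exists_chartPM`, Jacobian `N_R`) carries `[P, H]` onto
  `[M, 4 φ^{c-½-d} (4v(v(1-v)²-φ))^{d-1} v]`, `M = {0<v<1, 0<φ<v(1-v)²}`, and the chart `ρ(x,y) = (1-x, y x²(1-x))`
  of part 1 (`DdStep.exists_chartRho`, Jacobian `x²(1-x)`) carries the right box onto the same representation
  (rule (2) twice).

Everything is proved (polynomial identities and `Real.rpow` bookkeeping); no `def`, no named fact.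
-/

noncomputable section

open MeasureTheory Set
open Literature.ModelTheory.ExponentialFields (IsSemialgebraic)
open MvPolynomial (aeval X C)

namespace Summit.KontsevichZagierPeriods.FermatIsogeny.BetaProductSectorStubs

open Literature.NumberTheory.Transcendental
open Literature.NumberTheory.Transcendental.KZ

namespace DdStep

/-! ## The Euler–Mellin integrands of the right chain, unfolded -/

/-- The positive part `H = 4 F^{c-½-d} X^{d-1} (v·N_R)` of the left integrand, unfolded. [folklore] -/
theorem mellin_H_apply (c d : ℚ) (z : Fin 2 → ℝ) :
    KZ.mellinIntegrand (![(1 + X 0 - X 1) * (X 1 * (1 - X 1) - X 0 * (1 + X 0)),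
        4 * X 0 * X 1 * ((1 - X 1) ^ 2 + X 0 * (2 + X 0 - X 1)),
        X 1 * (3 * X 0 ^ 2 + 2 * (2 - X 1) * X 0 + (1 - X 1) ^ 2)] : Fin 3 → MvPolynomial (Fin 2) ℚ)
        ![c - 1 / 2 - d, d - 1, 1] 4 z =
      4 * (((1 + z 0 - z 1) * (z 1 * (1 - z 1) - z 0 * (1 + z 0))) ^ ((c:ℝ) - 1 / 2 - d) *
        (4 * z 0 * z 1 * ((1 - z 1) ^ 2 + z 0 * (2 + z 0 - z 1))) ^ ((d:ℝ) - 1) *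
        (z 1 * (3 * z 0 ^ 2 + 2 * (2 - z 1) * z 0 + (1 - z 1) ^ 2))) := by
  rw [KZ.mellinIntegrand_apply, Fin.prod_univ_three]
  simp only [Matrix.cons_val_zero, Matrix.cons_val_one, Matrix.cons_val, map_sub, map_mul, map_add, map_pow,
    map_one, map_ofNat, MvPolynomial.aeval_X]
  push_cast
  rw [Real.rpow_one]

/-- The ghost term `G = 4 F^{c-½-d} X^{d-1} (w·N_E)` on the lap `P₊`, unfolded. [folklore] -/
theorem mellin_Gp_apply (c d : ℚ) (z : Fin 2 → ℝ) :
    KZ.mellinIntegrand (![(1 + X 0 - X 1) * (X 1 * (1 - X 1) - X 0 * (1 + X 0)),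
        4 * X 0 * X 1 * ((1 - X 1) ^ 2 + X 0 * (2 + X 0 - X 1)),
        X 0 * (3 * X 1 ^ 2 - 2 * (2 + X 0) * X 1 + (1 + X 0) ^ 2)] : Fin 3 → MvPolynomial (Fin 2) ℚ)
        ![c - 1 / 2 - d, d - 1, 1] 4 z =
      4 * (((1 + z 0 - z 1) * (z 1 * (1 - z 1) - z 0 * (1 + z 0))) ^ ((c:ℝ) - 1 / 2 - d) *
        (4 * z 0 * z 1 * ((1 - z 1) ^ 2 + z 0 * (2 + z 0 - z 1))) ^ ((d:ℝ) - 1) *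
        (z 0 * (3 * z 1 ^ 2 - 2 * (2 + z 0) * z 1 + (1 + z 0) ^ 2))) := by
  rw [KZ.mellinIntegrand_apply, Fin.prod_univ_three]
  simp only [Matrix.cons_val_zero, Matrix.cons_val_one, Matrix.cons_val, map_sub, map_mul, map_add, map_pow,
    map_one, map_ofNat, MvPolynomial.aeval_X]
  push_cast
  rw [Real.rpow_one]

/-- The opposite ghost term `-G = 4 F^{c-½-d} X^{d-1} (w·(-N_E))` on the lap `P₋`, unfolded. [folklore] -/
theorem mellin_Gm_apply (c d : ℚ) (z : Fin 2 → ℝ) :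
    KZ.mellinIntegrand (![(1 + X 0 - X 1) * (X 1 * (1 - X 1) - X 0 * (1 + X 0)),
        4 * X 0 * X 1 * ((1 - X 1) ^ 2 + X 0 * (2 + X 0 - X 1)),
        X 0 * (-(3 * X 1 ^ 2 - 2 * (2 + X 0) * X 1 + (1 + X 0) ^ 2))] : Fin 3 → MvPolynomial (Fin 2) ℚ)
        ![c - 1 / 2 - d, d - 1, 1] 4 z =
      4 * (((1 + z 0 - z 1) * (z 1 * (1 - z 1) - z 0 * (1 + z 0))) ^ ((c:ℝ) - 1 / 2 - d) *
        (4 * z 0 * z 1 * ((1 - z 1) ^ 2 + z 0 * (2 + z 0 - z 1))) ^ ((d:ℝ) - 1) *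
        (z 0 * (-(3 * z 1 ^ 2 - 2 * (2 + z 0) * z 1 + (1 + z 0) ^ 2)))) := by
  rw [KZ.mellinIntegrand_apply, Fin.prod_univ_three]
  simp only [Matrix.cons_val_zero, Matrix.cons_val_one, Matrix.cons_val, map_sub, map_mul, map_add, map_pow,
    map_one, map_ofNat, map_neg, MvPolynomial.aeval_X]
  push_cast
  rw [Real.rpow_one]

/-- The integrand `4 φ^{c-½-d} (4v(v(1-v)²-φ))^{d-1} v` of the region `M` (coordinates `(v,φ)`), unfolded.
[folklore] -/
theorem mellin_M_apply (c d : ℚ) (y : Fin 2 → ℝ) :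
    KZ.mellinIntegrand (![X 1, 4 * X 0 * (X 0 * (1 - X 0) ^ 2 - X 1), X 0] : Fin 3 → MvPolynomial (Fin 2) ℚ)
        ![c - 1 / 2 - d, d - 1, 1] 4 y =
      4 * ((y 1) ^ ((c:ℝ) - 1 / 2 - d) * (4 * y 0 * (y 0 * (1 - y 0) ^ 2 - y 1)) ^ ((d:ℝ) - 1) * y 0) := by
  rw [KZ.mellinIntegrand_apply, Fin.prod_univ_three]
  simp only [Matrix.cons_val_zero, Matrix.cons_val_one, Matrix.cons_val, map_sub, map_mul, map_pow, map_one,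
    map_ofNat, MvPolynomial.aeval_X]
  push_cast
  rw [Real.rpow_one]

/-- The ghost integrand `4 φ^{c-½-d} (4(w²(1+w)²+wφ))^{d-1} w` of the image `E` (coordinates `(w,φ)`), unfolded.
[folklore] -/
theorem mellin_E_apply (c d : ℚ) (y : Fin 2 → ℝ) :
    KZ.mellinIntegrand (![X 1, 4 * (X 0 ^ 2 * (1 + X 0) ^ 2 + X 0 * X 1), X 0] : Fin 3 → MvPolynomial (Fin 2) ℚ)
        ![c - 1 / 2 - d, d - 1, 1] 4 y =
      4 * ((y 1) ^ ((c:ℝ) - 1 / 2 - d) * (4 * (y 0 ^ 2 * (1 + y 0) ^ 2 + y 0 * y 1)) ^ ((d:ℝ) - 1) * y 0) := by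
  rw [KZ.mellinIntegrand_apply, Fin.prod_univ_three]
  simp only [Matrix.cons_val_zero, Matrix.cons_val_one, Matrix.cons_val, map_mul, map_add, map_pow, map_one,
    map_ofNat, MvPolynomial.aeval_X]
  push_cast
  rw [Real.rpow_one]

/-- The weighted right box integrand `4 x^{2c-1} (1-x)^{c+d-½} y^{c-½-d} (4-4y)^{d-1}`
(`= 4^d x^{2c-1}(1-x)^{c+d-½} y^{c-½-d} (1-y)^{d-1}`), unfolded. [folklore] -/
theorem mellin_R_apply (c d : ℚ) (z : Fin 2 → ℝ) :
    KZ.mellinIntegrand (![X 0, 1 - X 0, X 1, 4 - 4 * X 1] : Fin 4 → MvPolynomial (Fin 2) ℚ)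
        ![2 * c - 1, c + d + 1 / 2 - 1, c + 1 / 2 - d - 1, d - 1] 4 z =
      4 * ((z 0) ^ (2 * (c:ℝ) - 1) * (1 - z 0) ^ ((c:ℝ) + d + 1 / 2 - 1) * (z 1) ^ ((c:ℝ) + 1 / 2 - d - 1) *
        (4 - 4 * z 1) ^ ((d:ℝ) - 1)) := by
  rw [KZ.mellinIntegrand_apply, Fin.prod_univ_four]
  simp only [Matrix.cons_val_zero, Matrix.cons_val_one, Matrix.cons_val, map_sub, map_mul, map_one, map_ofNat,
    MvPolynomial.aeval_X]
  push_cast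
  ring_nf

/-! ## Pointwise identities of the right chain -/

/-- **The split `ℓ = H + G`** of the left integrand (`D(v+w) = v·N_R + w·N_E`). [folklore] -/
theorem left_eq_H_add_Gp (c d : ℚ) (z : Fin 2 → ℝ) :
    KZ.mellinIntegrand (![(1 + X 0 - X 1) * (X 1 * (1 - X 1) - X 0 * (1 + X 0)),
        4 * X 0 * X 1 * ((1 - X 1) ^ 2 + X 0 * (2 + X 0 - X 1)),
        (X 0 ^ 2 + 2 * X 0 + (1 - X 1) ^ 2) * (X 1 + X 0)] : Fin 3 → MvPolynomial (Fin 2) ℚ)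
        ![c - 1 / 2 - d, d - 1, 1] 4 z =
      KZ.mellinIntegrand (![(1 + X 0 - X 1) * (X 1 * (1 - X 1) - X 0 * (1 + X 0)),
        4 * X 0 * X 1 * ((1 - X 1) ^ 2 + X 0 * (2 + X 0 - X 1)),
        X 1 * (3 * X 0 ^ 2 + 2 * (2 - X 1) * X 0 + (1 - X 1) ^ 2)] : Fin 3 → MvPolynomial (Fin 2) ℚ)
        ![c - 1 / 2 - d, d - 1, 1] 4 z +
      KZ.mellinIntegrand (![(1 + X 0 - X 1) * (X 1 * (1 - X 1) - X 0 * (1 + X 0)),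
        4 * X 0 * X 1 * ((1 - X 1) ^ 2 + X 0 * (2 + X 0 - X 1)),
        X 0 * (3 * X 1 ^ 2 - 2 * (2 + X 0) * X 1 + (1 + X 0) ^ 2)] : Fin 3 → MvPolynomial (Fin 2) ℚ)
        ![c - 1 / 2 - d, d - 1, 1] 4 z := by
  rw [mellin_left_apply, mellin_H_apply, mellin_Gp_apply]
  ring

/-- **The split `H = ℓ + (-G)`** on the other lap. [folklore] -/
theorem H_eq_left_add_Gm (c d : ℚ) (z : Fin 2 → ℝ) :
    KZ.mellinIntegrand (![(1 + X 0 - X 1) * (X 1 * (1 - X 1) - X 0 * (1 + X 0)),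
        4 * X 0 * X 1 * ((1 - X 1) ^ 2 + X 0 * (2 + X 0 - X 1)),
        X 1 * (3 * X 0 ^ 2 + 2 * (2 - X 1) * X 0 + (1 - X 1) ^ 2)] : Fin 3 → MvPolynomial (Fin 2) ℚ)
        ![c - 1 / 2 - d, d - 1, 1] 4 z =
      KZ.mellinIntegrand (![(1 + X 0 - X 1) * (X 1 * (1 - X 1) - X 0 * (1 + X 0)),
        4 * X 0 * X 1 * ((1 - X 1) ^ 2 + X 0 * (2 + X 0 - X 1)),
        (X 0 ^ 2 + 2 * X 0 + (1 - X 1) ^ 2) * (X 1 + X 0)] : Fin 3 → MvPolynomial (Fin 2) ℚ)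
        ![c - 1 / 2 - d, d - 1, 1] 4 z +
      KZ.mellinIntegrand (![(1 + X 0 - X 1) * (X 1 * (1 - X 1) - X 0 * (1 + X 0)),
        4 * X 0 * X 1 * ((1 - X 1) ^ 2 + X 0 * (2 + X 0 - X 1)),
        X 0 * (-(3 * X 1 ^ 2 - 2 * (2 + X 0) * X 1 + (1 + X 0) ^ 2))] : Fin 3 → MvPolynomial (Fin 2) ℚ)
        ![c - 1 / 2 - d, d - 1, 1] 4 z := by
  rw [mellin_left_apply, mellin_H_apply, mellin_Gm_apply]
  ring

/-- Pull-back of the `M` integrand along the chart `(w,v) ↦ (v, F)`, times the Jacobian `N_R`: the positive part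
`H` (`4v(v(1-v)² - F) = X`). [folklore] -/
theorem right_pullback_PM (A B : ℝ) (w v : ℝ) :
    4 * (((1 + w - v) * (v * (1 - v) - w * (1 + w))) ^ A *
        (4 * v * (v * (1 - v) ^ 2 - (1 + w - v) * (v * (1 - v) - w * (1 + w)))) ^ B * v) *
        (3 * w ^ 2 + 2 * (2 - v) * w + (1 - v) ^ 2) =
      4 * (((1 + w - v) * (v * (1 - v) - w * (1 + w))) ^ A * (4 * w * v * ((1 - v) ^ 2 + w * (2 + w - v))) ^ B *
        (v * (3 * w ^ 2 + 2 * (2 - v) * w + (1 - v) ^ 2))) := by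
  have e : 4 * v * (v * (1 - v) ^ 2 - (1 + w - v) * (v * (1 - v) - w * (1 + w))) =
      4 * w * v * ((1 - v) ^ 2 + w * (2 + w - v)) := by ring
  rw [e]
  ring

/-- Pull-back of the ghost integrand along the ghost chart `(w,v) ↦ (w, F)`, times a factor `t` (`= ±N_E`):
the ghost term (`4(w²(1+w)² + wF) = X`). [folklore] -/
theorem right_pullback_PE (A B : ℝ) (w v t : ℝ) :
    4 * (((1 + w - v) * (v * (1 - v) - w * (1 + w))) ^ A *
        (4 * (w ^ 2 * (1 + w) ^ 2 + w * ((1 + w - v) * (v * (1 - v) - w * (1 + w))))) ^ B * w) * t =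
      4 * (((1 + w - v) * (v * (1 - v) - w * (1 + w))) ^ A * (4 * w * v * ((1 - v) ^ 2 + w * (2 + w - v))) ^ B *
        (w * t)) := by
  have e : 4 * (w ^ 2 * (1 + w) ^ 2 + w * ((1 + w - v) * (v * (1 - v) - w * (1 + w)))) =
      4 * w * v * ((1 - v) ^ 2 + w * (2 + w - v)) := by ring
  rw [e]
  ring

/-- Pull-back of the `M` integrand along the chart `ρ(x,y) = (1-x, y x²(1-x))`, times the Jacobian `x²(1-x)`: the
weighted right box integrand. [folklore] -/
theorem right_pullback_rho : ∀ (c d : ℝ) {x y : ℝ}, 0 < x → x < 1 → 0 < y → y < 1 → 4 * ((y * x ^ 2 * (1 - x)) ^ (c - 1 / 2 - d) * (4 * (1 - x) * ((1 - x) * (1 - (1 - x)) ^ 2 - y * x ^ 2 * (1 - x))) ^ (d - 1) * (1 - x)) * (x ^ 2 * (1 - x)) = 4 * (x ^ (2 * c - 1) * (1 - x) ^ (c + d + 1 / 2 - 1) * y ^ (c + 1 / 2 - d - 1) * (4 - 4 * y) ^ (d - 1)) := by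
  intro c d x y hx hx1 hy hy1
  have h1x : 0 < 1 - x := sub_pos.2 hx1
  have h4y : 0 ≤ 4 - 4 * y := by linarith
  have hx2 : 0 ≤ x ^ 2 * (1 - x) := by positivity
  have e1 : y * x ^ 2 * (1 - x) = y * (x ^ 2 * (1 - x)) := by ring
  have e2 : 4 * (1 - x) * ((1 - x) * (1 - (1 - x)) ^ 2 - y * x ^ 2 * (1 - x)) =
      (x ^ 2 * (1 - x) ^ 2) * (4 - 4 * y) := by ring
  have hxpow : x ^ (2 * c - 1) = (x ^ 2) ^ (c - 1 / 2 - d) * (x ^ 2) ^ (d - 1) * x ^ 2 := by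
    rw [← Real.rpow_two, ← Real.rpow_mul hx.le, ← Real.rpow_mul hx.le, ← Real.rpow_add hx, ← Real.rpow_add hx]
    congr 1
    ring
  have h1xpow : (1 - x) ^ (c + d + 1 / 2 - 1) =
      (1 - x) ^ (c - 1 / 2 - d) * ((1 - x) ^ 2) ^ (d - 1) * (1 - x) * (1 - x) := by
    rw [← Real.rpow_two, ← Real.rpow_mul h1x.le, ← Real.rpow_add h1x, ← Real.rpow_add_one h1x.ne',
      ← Real.rpow_add_one h1x.ne']
    congr 1
    ring
  have hypow : y ^ (c + 1 / 2 - d - 1) = y ^ (c - 1 / 2 - d) := by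
    congr 1
    ring
  rw [e2, e1, Real.mul_rpow hy.le hx2, Real.mul_rpow (sq_nonneg x) h1x.le, Real.mul_rpow (by positivity) h4y,
    Real.mul_rpow (sq_nonneg x) (sq_nonneg (1 - x)), hxpow, h1xpow, hypow]
  ring

/-- The weight bookkeeping `4·(4-4y)^{d-1} = 4^d (1-y)^{d-1}` of the right box. [folklore] -/
theorem four_mul_rpow_key (d : ℝ) {y : ℝ} (hy1 : y < 1) :
    4 * (4 - 4 * y) ^ (d - 1) = (4:ℝ) ^ d * (1 - y) ^ (d - 1) := by
  have e : (4 - 4 * y) = 4 * (1 - y) := by ring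
  rw [e, Real.mul_rpow (by norm_num : (0:ℝ) ≤ 4) (by linarith), Real.rpow_sub_one (by norm_num : (4:ℝ) ≠ 0)]
  ring

end DdStep

end Summit.KontsevichZagierPeriods.FermatIsogeny.BetaProductSectorStubs

end
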